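import Mathlib.MeasureTheory.Measure.Haar.NormedSpace
import Mathlib.MeasureTheory.Measure.Haar.InnerProductSpace
import Mathlib.MeasureTheory.Function.LpSeminorm.Basic
import Mathlib.Analysis.InnerProductSpace.PiL2
import HarnessLib

/-!
# Route `EfficiencyFloor`, crux `MaximiserSetRigidity` (stmt-NavierStokesRegularity-25512), part (b), rotating case:
# the `L³(ℝ³)` norm is constant along a (rotating) self-similar orbit

Helper file (`--supports stmt-NavierStokesRegularity-25512`), route-independent (Mathlib only). Third brick of the
orbit argument for the driftless rotating collapse Liouville theorem (L⁺_rot) (bricks 1–2: `…RotatingDrift`,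
`…OrbitBlowup`): the slices `x ↦ λ • R (m (λ • R⁻¹ x))` (`λ > 0`, `R` a linear isometry of `ℝ³`) of the orbit of a
profile `m` all have the same `L³` norm as `m` — the scale invariance of `L³(ℝ³)` under the Navier–Stokes scaling
`m ↦ λ m(λ ·)` combined with rotation invariance of Lebesgue measure. This is what makes Seregin's criterion
(`Literature.Analysis.FluidPDE.seregin_L3_blowup_holds`: `‖u(t)‖₃ → ∞` at a maximal time) bite on such an orbit.

* `lintegral_comp_smul_isometry` — `∫ G(λ • R⁻¹ x) dx = (λ³)⁻¹ ∫ G` on `ℝ³` (`G ≥ 0` measurable or not);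
* `lintegral_enorm_rpow_three_selfSimilarSlice` — `∫ |λ R m(λ R⁻¹ x)|³ dx = ∫ |m|³`;
* `eLpNorm_three_selfSimilarSlice` — `‖λ • R (m (λ • R⁻¹ ·))‖_{L³} = ‖m‖_{L³}`.

HONEST FRAMING: a brick; (L⁺_rot), stmt-25512, `ProductionEfficiencyDecay` and Navier–Stokes regularity stay OPEN; no
summit statement is proved. [folklore]
-/

noncomputable section

-- the problem directory repeats the summit name (`NavierStokesRegularity/NavierStokesRegularity`)
set_option linter.dupNamespace false

namespace Summit.NavierStokesRegularity.NavierStokesRegularity.Theorems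

namespace MaximiserSetRigidity

namespace RotatingOrbit

open MeasureTheory Set Function Module
open scoped ENNReal

/-- **Change of variables under scaling composed with an isometry on `ℝ³`:**
`∫ G(λ • R⁻¹ x) dx = (λ³)⁻¹ · ∫ G(y) dy` for `λ ≠ 0` and a linear isometry `R` (Lebesgue measure is rotation
invariant and scales by `|λ|³`; no measurability of `G` is needed, both maps being measurable embeddings). [folklore] -/
theorem lintegral_comp_smul_isometry (G : EuclideanSpace ℝ (Fin 3) → ℝ≥0∞)
    (R : EuclideanSpace ℝ (Fin 3) ≃ₗᵢ[ℝ] EuclideanSpace ℝ (Fin 3)) {lam : ℝ} (hlam : lam ≠ 0) :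
    ∫⁻ x, G (lam • R.symm x) = ENNReal.ofReal |(lam ^ 3)⁻¹| * ∫⁻ y, G y := by
  -- first the isometry: `∫ H(R⁻¹ x) dx = ∫ H`
  have hR : MeasurePreserving (R.symm : EuclideanSpace ℝ (Fin 3) → EuclideanSpace ℝ (Fin 3)) volume volume :=
    R.symm.measurePreserving
  have hRemb : MeasurableEmbedding (R.symm : EuclideanSpace ℝ (Fin 3) → EuclideanSpace ℝ (Fin 3)) :=
    R.symm.toHomeomorph.measurableEmbedding
  have h1 : ∫⁻ x, G (lam • R.symm x) = ∫⁻ z, G (lam • z) := by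
    have h := hRemb.lintegral_map (μ := volume) (fun z => G (lam • z))
    rw [hR.map_eq] at h
    exact h.symm
  -- then the scaling
  have hSemb : MeasurableEmbedding (fun z : EuclideanSpace ℝ (Fin 3) => lam • z) :=
    (Homeomorph.smul (Units.mk0 lam hlam)).measurableEmbedding
  have h2 : ∫⁻ z, G (lam • z) = ENNReal.ofReal |(lam ^ 3)⁻¹| * ∫⁻ y, G y := by
    have h := hSemb.lintegral_map (μ := volume) G
    rw [Measure.map_addHaar_smul volume hlam, finrank_euclideanSpace_fin, lintegral_smul_measure,
      smul_eq_mul] at h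
    exact h.symm
  rw [h1, h2]

/-- **`∫ |λ R m(λ R⁻¹ x)|³ dx = ∫ |m|³`** for `λ > 0` and a linear isometry `R` of `ℝ³`: the pointwise factor `λ³` from
the amplitude cancels the Jacobian `λ⁻³`. [folklore] -/
theorem lintegral_enorm_rpow_three_selfSimilarSlice (m : EuclideanSpace ℝ (Fin 3) → EuclideanSpace ℝ (Fin 3))
    (R : EuclideanSpace ℝ (Fin 3) ≃ₗᵢ[ℝ] EuclideanSpace ℝ (Fin 3)) {lam : ℝ} (hlam : 0 < lam) :
    ∫⁻ x, ‖lam • R (m (lam • R.symm x))‖ₑ ^ (3 : ℝ) = ∫⁻ y, ‖m y‖ₑ ^ (3 : ℝ) := by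
  have hpt : ∀ x, ‖lam • R (m (lam • R.symm x))‖ₑ ^ (3 : ℝ) =
      ENNReal.ofReal lam ^ (3 : ℝ) * (fun y => ‖m y‖ₑ ^ (3 : ℝ)) (lam • R.symm x) := by
    intro x
    have hn : ‖lam • R (m (lam • R.symm x))‖ = lam * ‖m (lam • R.symm x)‖ := by
      rw [norm_smul, LinearIsometryEquiv.norm_map, Real.norm_eq_abs, abs_of_pos hlam]
    rw [← ofReal_norm, hn, ENNReal.ofReal_mul hlam.le, ofReal_norm,
      ENNReal.mul_rpow_of_nonneg _ _ (by norm_num)]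
  simp_rw [hpt]
  have hcv := lintegral_comp_smul_isometry (fun y => ‖m y‖ₑ ^ (3 : ℝ)) R hlam.ne'
  rw [lintegral_const_mul' _ _ (by simp), hcv, ← mul_assoc]
  have hfac : ENNReal.ofReal lam ^ (3 : ℝ) * ENNReal.ofReal |(lam ^ 3)⁻¹| = 1 := by
    have e3 : ENNReal.ofReal lam ^ (3 : ℝ) = ENNReal.ofReal (lam ^ 3) := by
      rw [show (3 : ℝ) = ((3 : ℕ) : ℝ) by norm_num, ENNReal.rpow_natCast, ENNReal.ofReal_pow hlam.le]
    rw [e3, abs_of_pos (inv_pos.2 (pow_pos hlam 3)), ← ENNReal.ofReal_mul (pow_pos hlam 3).le,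
      mul_inv_cancel₀ (pow_pos hlam 3).ne', ENNReal.ofReal_one]
  rw [hfac, one_mul]

/-- **`L³(ℝ³)` is invariant along a (rotating) self-similar orbit:** `‖λ • R (m (λ • R⁻¹ ·))‖_{L³} = ‖m‖_{L³}` for
`λ > 0` and a linear isometry `R`. Along the orbit `u(t) = λ(t) R(t) m(λ(t) R(t)⁻¹ ·)` of a rotating backward
self-similar profile this is the constancy of `‖u(t)‖₃`, incompatible with Seregin's `‖u(t)‖₃ → ∞` unless
`‖m‖₃ = ∞`. [folklore] -/
theorem eLpNorm_three_selfSimilarSlice (m : EuclideanSpace ℝ (Fin 3) → EuclideanSpace ℝ (Fin 3))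
    (R : EuclideanSpace ℝ (Fin 3) ≃ₗᵢ[ℝ] EuclideanSpace ℝ (Fin 3)) {lam : ℝ} (hlam : 0 < lam) :
    eLpNorm (fun x => lam • R (m (lam • R.symm x))) 3 volume = eLpNorm m 3 volume := by
  have h3 : (3 : ℝ≥0∞) ≠ 0 := by norm_num
  have h3' : (3 : ℝ≥0∞) ≠ ⊤ := by norm_num
  rw [eLpNorm_eq_lintegral_rpow_enorm_toReal h3 h3', eLpNorm_eq_lintegral_rpow_enorm_toReal h3 h3']
  have ht : (3 : ℝ≥0∞).toReal = 3 := by norm_num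
  rw [ht, lintegral_enorm_rpow_three_selfSimilarSlice m R hlam]

end RotatingOrbit

end MaximiserSetRigidity

end Summit.NavierStokesRegularity.NavierStokesRegularity.Theorems

end
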